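import Literature.Analysis.PDE.PatchLocalization
import Literature.Analysis.PDE.LinApriori
import HarnessLib

/-!
# Gluing chart-wise constructions: slab-smooth globalisation and the transport multipliers between
# the partition localisation and the cut-off localisation (topic `Analysis/PDE`)

Analytic–geometric layer of the programme to prove short-time existence for quasilinear
strictly parabolic systems on a closed manifold (hypothesis `hQL` of
`Literature.Geometry.Riemannian.ricciFlow_shortTime_existence_of_quasilinear`). The existence
construction works chart by chart on a patch system `P` and glues with the cut-offs: a time
dependent field `g` on the model produced in chart `p` is pulled back as `κ_p.globalize (g s)`,
and a source `f` on `M` is localised to chart `q` as the **partition expression**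
`rhoExpr P q f = ρ̂_q • f ∘ κ_q⁻¹` (so that `Σ_q globalize_q (rhoExpr q f) = f`). This file proves
the bookkeeping facts of this gluing:

* `contDiffOn_slab_globalize_comp_inv` — chart expressions of the globalisation of a slab-smooth
  field supported in a fixed compact subset of the target are slab-smooth in EVERY chart;
  `derivWithin_globalize` — time derivatives pass through the globalisation;
  `sum_globalize_rhoExpr` — the partition expressions reassemble the source;
* the **transport multipliers**: for smooth `θ` supported compactly in the target of `κ'` and
  `g₀` supported compactly in the target of `κ`, the multiplier `y ↦ θ y * globalize_κ g₀ (κ'⁻¹ y)`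
  is smooth with support in a compact subset of the overlap (`contDiff_mul_globalize_comp_inv`,
  `exists_compact_tsupport_mul_globalize_subset`);
* the two **transport identities** `rhoExpr q (globalize_p g) = m_A • g ∘ τ_{qp}` (for `g`
  supported in `tsupport cut_p`, `rhoExpr_globalize_eq`) and
  `cutExpr p f = Σ_q m_B • (rhoExpr q f) ∘ τ_{pq}` (`cutExpr_eq_sum_rhoExpr`), whose summands are
  transports with multipliers compactly supported in the overlaps, hence bounded in every
  Sobolev energy by `PatchSystemLoc.sobolevEnergy_smul_comp_transition_le`
  (`exists_rhoExpr_globalize_le`, `exists_cutExpr_le_sum_rhoExpr`).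

Everything is proved; no named fact and no `sorry` is introduced.

## References

* J. M. Lee, *Introduction to Smooth Manifolds*, 2nd ed., Springer 2013, Ch. 2 and Thm. 2.23
  (gluing with partitions of unity and bump functions). [Lee2013]
* R. A. Adams, *Sobolev Spaces*, Academic Press 1975, Thm. 3.35. [Adams1975]
-/

noncomputable section

open Set Function Filter Topology Metric MeasureTheory
open scoped Manifold ContDiff Topology ENNReal

namespace Literature.Analysis.PDE

open Literature.Geometry.Manifold Literature.Analysis.FluidPDE

variable {E : Type*} [NormedAddCommGroup E] [NormedSpace ℝ E] {H : Type*} [TopologicalSpace H]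
variable {I : ModelWithCorners ℝ E H} {M : Type*} [TopologicalSpace M] [ChartedSpace H M]
variable {E' : Type*} [NormedAddCommGroup E'] [InnerProductSpace ℝ E'] [FiniteDimensional ℝ E']
variable {F : Type*} [NormedAddCommGroup F] [NormedSpace ℝ F]

/-! ### Slab-smooth globalisation -/

namespace SlabGlue

omit [FiniteDimensional ℝ E'] in
/-- **Time derivatives pass through the globalisation.** [folklore] -/
theorem derivWithin_globalize (κ : FramedChart I M E') (g : ℝ → E' → F) (S : Set ℝ) (s : ℝ) (x : M) :
    derivWithin (fun s ↦ κ.globalize (g s) x) S s = κ.globalize (timeDerivWithin S g s) x := by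
  by_cases hx : x ∈ κ.source
  · simp only [κ.globalize_of_mem hx, timeDerivWithin_apply]
  · simp [κ.globalize_of_notMem hx]

omit [FiniteDimensional ℝ E'] in
/-- **Chart expressions of the globalisation of a slab-smooth field are slab-smooth**: if `g` is
smooth on `S ×ˢ κ.target` with `tsupport (g s) ⊆ K` for all `s`, `K` compact, `K ⊆ κ.target`, then
`(s, y) ↦ κ.globalize (g s) (κ'.inv y)` is smooth on `S ×ˢ κ'.target` for every framed chart `κ'`.
[cite: Lee2013, Ch. 2] -/
theorem contDiffOn_slab_globalize_comp_inv [IsManifold I ∞ M] [I.Boundaryless] [T2Space M]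
    (κ κ' : FramedChart I M E') {S : Set ℝ} {g : ℝ → E' → F} (hg : ContDiffOn ℝ ∞ (uncurry g) (S ×ˢ κ.target))
    {K : Set E'} (hK : IsCompact K) (hKt : K ⊆ κ.target) (hgK : ∀ s, tsupport (g s) ⊆ K) :
    ContDiffOn ℝ ∞ (uncurry fun s y ↦ κ.globalize (g s) (κ'.inv y)) (S ×ˢ κ'.target) := by
  rintro ⟨s, y⟩ hsy
  have hs : s ∈ S := (mem_prod.1 hsy).1
  have hy : y ∈ κ'.target := (mem_prod.1 hsy).2
  obtain ⟨hKc, hKs⟩ := κ.isCompact_image_inv hK hKt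
  have hKcl : IsClosed (κ.inv '' K) := hKc.isClosed
  by_cases hys : κ'.inv y ∈ κ.source
  · -- on the overlap the chart expression is `g s ∘ transition`
    have hyo : y ∈ κ'.overlap κ := (κ'.mem_overlap_iff κ).2 ⟨hy, hys⟩
    have hO := κ'.isOpen_overlap κ
    have hsm : ContDiffOn ℝ ∞ (uncurry fun s y ↦ g s (κ'.transition κ y)) (S ×ˢ κ'.overlap κ) := by
      have h1 : ContDiffOn ℝ ∞ (fun q : ℝ × E' ↦ (q.1, κ'.transition κ q.2)) (S ×ˢ κ'.overlap κ) :=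
        contDiffOn_fst.prodMk ((κ'.contDiffOn_transition κ).comp contDiffOn_snd fun q hq ↦ (mem_prod.1 hq).2)
      refine hg.comp h1 fun q hq ↦ mk_mem_prod (mem_prod.1 hq).1 ?_
      exact κ.overlap_subset_target κ' (κ'.transition_mem_overlap κ (mem_prod.1 hq).2)
    have heq : EqOn (uncurry fun s y ↦ κ.globalize (g s) (κ'.inv y)) (uncurry fun s y ↦ g s (κ'.transition κ y))
        (S ×ˢ κ'.overlap κ) := by
      rintro ⟨s₁, y₁⟩ hq
      obtain ⟨_, hy₁s⟩ := (κ'.mem_overlap_iff κ).1 (mem_prod.1 hq).2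
      simp only [uncurry, FramedChart.transition_apply]
      exact κ.globalize_of_mem hy₁s
    have h2 : ContDiffWithinAt ℝ ∞ (uncurry fun s y ↦ κ.globalize (g s) (κ'.inv y)) (S ×ˢ κ'.overlap κ) (s, y) :=
      (hsm (s, y) (mk_mem_prod hs hyo)).congr heq (heq (mk_mem_prod hs hyo))
    refine h2.mono_of_mem_nhdsWithin ?_
    refine mem_nhdsWithin.2 ⟨univ ×ˢ κ'.overlap κ, isOpen_univ.prod hO, mk_mem_prod (mem_univ _) hyo, ?_⟩
    rintro ⟨s', y'⟩ ⟨h1, h2⟩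
    exact mk_mem_prod (mem_prod.1 h2).1 (mem_prod.1 h1).2
  · -- off the source of `κ` the globalisation vanishes near `κ'.inv y`, for all times
    have hyK : κ'.inv y ∉ κ.inv '' K := fun h ↦ hys (hKs h)
    have hU : IsOpen (κ'.target ∩ κ'.inv ⁻¹' (κ.inv '' K)ᶜ) :=
      κ'.continuousOn_inv.isOpen_inter_preimage κ'.isOpen_target hKcl.isOpen_compl
    have hyU : y ∈ κ'.target ∩ κ'.inv ⁻¹' (κ.inv '' K)ᶜ := ⟨hy, hyK⟩
    have hzero : ∀ s', ∀ y₁ ∈ κ'.target ∩ κ'.inv ⁻¹' (κ.inv '' K)ᶜ, κ.globalize (g s') (κ'.inv y₁) = 0 := by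
      intro s' y₁ hy₁
      refine κ.globalize_eq_zero fun h ↦ hy₁.2 ?_
      rw [κ.image_inv_eq hKt]
      exact ⟨h.1, hgK s' h.2⟩
    have hev : (uncurry fun s y ↦ κ.globalize (g s) (κ'.inv y)) =ᶠ[𝓝 (s, y)] fun _ ↦ 0 := by
      filter_upwards [(isOpen_univ.prod hU).mem_nhds (mk_mem_prod (mem_univ s) hyU)] with q hq
      exact hzero q.1 q.2 (mem_prod.1 hq).2
    exact ((contDiffAt_const (c := (0 : F))).congr_of_eventuallyEq hev).contDiffWithinAt

omit [FiniteDimensional ℝ E'] in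
/-- Sums of chart-slab-smooth fields are chart-slab-smooth. [folklore] -/
theorem contDiffOn_slab_sum {κ' : FramedChart I M E'} {S : Set ℝ} {ι' : Type*} (t : Finset ι') {V : ι' → ℝ → M → F}
    (hV : ∀ i ∈ t, ContDiffOn ℝ ∞ (uncurry fun s y ↦ V i s (κ'.inv y)) (S ×ˢ κ'.target)) :
    ContDiffOn ℝ ∞ (uncurry fun s y ↦ ∑ i ∈ t, V i s (κ'.inv y)) (S ×ˢ κ'.target) := by
  have : (uncurry fun s y ↦ ∑ i ∈ t, V i s (κ'.inv y)) = fun q ↦ ∑ i ∈ t, (uncurry fun s y ↦ V i s (κ'.inv y)) q := by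
    funext ⟨s, y⟩; simp
  rw [this]
  exact ContDiffOn.sum hV

end SlabGlue

/-! ### The partition expression of a source -/

variable {ι : Type*} [Fintype ι] (P : PatchSystem I M E' ι)

namespace PatchSystemLoc

/-- **The partition expression** `rhoExpr P q f = ρ̂_q • f ∘ κ_q⁻¹` of a function `f` on `M`
(the product form; `ρ̂_q` vanishes off the target, so no zero-extension is needed).
[cite: Lee2013, Thm. 2.23] -/
def rhoExpr (q : ι) (f : M → F) (y : E') : F := P.rhoHat q y • f ((P.chart q).inv y)

/-- `rhoExpr_apply`: unfolding. [folklore] -/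
theorem rhoExpr_apply (q : ι) (f : M → F) (y : E') : rhoExpr P q f y = P.rhoHat q y • f ((P.chart q).inv y) := rfl

/-- The partition expression vanishes off `closedBall 0 (2r_q)`. [folklore] -/
theorem rhoExpr_eq_zero (q : ι) (f : M → F) {y : E'} (hy : y ∉ closedBall (0 : E') (2 * P.r q)) : rhoExpr P q f y = 0 := by
  rw [rhoExpr_apply, image_eq_zero_of_notMem_tsupport fun h ↦ hy (P.tsupport_rhoHat_subset q h), zero_smul]

/-- `tsupport (rhoExpr q f) ⊆ closedBall 0 (2r_q)`. [folklore] -/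
theorem tsupport_rhoExpr_subset (q : ι) (f : M → F) : tsupport (rhoExpr P q f) ⊆ closedBall (0 : E') (2 * P.r q) :=
  closure_minimal (fun y hy ↦ by by_contra h; exact hy (rhoExpr_eq_zero P q f h)) isClosed_closedBall

/-- **The partition expressions reassemble the source**: `Σ_q globalize_q (rhoExpr q f) = f`.
[cite: Lee2013, Thm. 2.23] -/
theorem sum_globalize_rhoExpr (f : M → F) (x : M) : ∑ q, (P.chart q).globalize (rhoExpr P q f) x = f x := by
  have h : ∀ q, (P.chart q).globalize (rhoExpr P q f) x = P.rho q x • f x := by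
    intro q
    by_cases hx : x ∈ (P.chart q).source
    · rw [(P.chart q).globalize_of_mem hx, rhoExpr_apply, P.rhoHat_map q hx, (P.chart q).inv_map hx]
    · rw [(P.chart q).globalize_of_notMem hx, P.rho_eq_zero_of_notMem q hx, zero_smul]
  simp only [h, ← Finset.sum_smul, P.sum_rho x, one_smul]

variable [IsManifold I ∞ M] [I.Boundaryless] [T2Space M]

/-- **The partition expression of a chart-slab-smooth field is slab-smooth on the whole model.**
[folklore] -/
theorem contDiffOn_slab_rhoExpr (q : ι) {S : Set ℝ} {f : ℝ → M → F}
    (hf : ContDiffOn ℝ ∞ (uncurry fun s y ↦ f s ((P.chart q).inv y)) (S ×ˢ (P.chart q).target)) :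
    ContDiffOn ℝ ∞ (uncurry fun s y ↦ rhoExpr P q (f s) y) (S ×ˢ univ) :=
  contDiffOn_slab_smul_of_tsupport_subset (P.chart q).isOpen_target (P.contDiff_rhoHat q)
    ((P.tsupport_rhoHat_subset q).trans (P.closedBall_subset_target q (by norm_num))) hf

/-- The partition expression of a function with smooth chart expressions is smooth. [folklore] -/
theorem contDiff_rhoExpr (q : ι) {f : M → F} (hf : ContDiffOn ℝ ∞ (f ∘ (P.chart q).inv) (P.chart q).target) :
    ContDiff ℝ ∞ (rhoExpr P q f) :=
  contDiff_smul_of_tsupport_subset (P.chart q).isOpen_target (P.contDiff_rhoHat q)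
    ((P.tsupport_rhoHat_subset q).trans (P.closedBall_subset_target q (by norm_num))) hf

/-! ### Transport multipliers -/

omit [FiniteDimensional ℝ E'] [Fintype ι] in
/-- **Multipliers of the form `θ · (globalize_κ g₀) ∘ κ'⁻¹` are smooth** when `θ` is smooth with
support inside the target of `κ'` and `g₀` is smooth with support in a compact subset of the
target of `κ`. [cite: Lee2013, Ch. 2] -/
theorem contDiff_mul_globalize_comp_inv (κ κ' : FramedChart I M E') {θ : E' → ℝ} (hθ : ContDiff ℝ ∞ θ)
    (hθt : tsupport θ ⊆ κ'.target) {g₀ : E' → ℝ} (hg₀ : ContDiff ℝ ∞ g₀) {C : Set E'} (hC : IsCompact C)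
    (hCt : C ⊆ κ.target) (hg₀C : tsupport g₀ ⊆ C) :
    ContDiff ℝ ∞ fun y ↦ θ y * κ.globalize g₀ (κ'.inv y) := by
  have h := contDiff_smul_of_tsupport_subset κ'.isOpen_target hθ hθt
    (κ.contDiffOn_globalize_comp_inv κ' hg₀.contDiffOn hC hCt hg₀C)
  simpa only [smul_eq_mul, Function.comp_apply] using h

omit [FiniteDimensional ℝ E'] [Fintype ι] [IsManifold I ∞ M] [I.Boundaryless] in
/-- **The support of such a multiplier lies in a compact subset of the overlap**:
`tsupport (θ · globalize_κ g₀ ∘ κ'⁻¹) ⊆ κ'.map (κ'⁻¹ Cθ ∩ κ⁻¹ C) ⊆ overlap κ' κ`. [folklore] -/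
theorem exists_compact_tsupport_mul_globalize_subset (κ κ' : FramedChart I M E') {θ : E' → ℝ} {Cθ : Set E'}
    (hCθ : IsCompact Cθ) (hCθt : Cθ ⊆ κ'.target) (hθC : tsupport θ ⊆ Cθ) {g₀ : E' → ℝ} {C : Set E'}
    (hC : IsCompact C) (hCt : C ⊆ κ.target) (hg₀C : tsupport g₀ ⊆ C) :
    ∃ K : Set E', IsCompact K ∧ K ⊆ κ'.overlap κ ∧ tsupport (fun y ↦ θ y * κ.globalize g₀ (κ'.inv y)) ⊆ K := by
  obtain ⟨hC1, hC1s⟩ := κ'.isCompact_image_inv hCθ hCθt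
  obtain ⟨hC2, hC2s⟩ := κ.isCompact_image_inv hC hCt
  set KM : Set M := κ'.inv '' Cθ ∩ κ.inv '' C with hKM
  have hKMc : IsCompact KM := hC1.inter_right hC2.isClosed
  have hKM1 : KM ⊆ κ'.source := fun x hx ↦ hC1s hx.1
  have hKM2 : KM ⊆ κ.source := fun x hx ↦ hC2s hx.2
  obtain ⟨hK, _⟩ := κ'.isCompact_image_map hKMc hKM1
  refine ⟨κ'.map '' KM, hK, ?_, ?_⟩
  · rintro y ⟨x, hx, rfl⟩
    exact κ'.map_mem_overlap κ (hKM1 hx) (hKM2 hx)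
  · refine closure_minimal (fun y hy ↦ ?_) hK.isClosed
    rw [mem_support] at hy
    have hθy : θ y ≠ 0 := left_ne_zero_of_mul hy
    have hgy : κ.globalize g₀ (κ'.inv y) ≠ 0 := right_ne_zero_of_mul hy
    have hyC : y ∈ Cθ := hθC (subset_tsupport _ hθy)
    have hyt : y ∈ κ'.target := hCθt hyC
    have hxs : κ'.inv y ∈ κ.source := by
      by_contra h; exact hgy (κ.globalize_of_notMem h)
    rw [κ.globalize_of_mem hxs] at hgy
    have hmC : κ.map (κ'.inv y) ∈ C := hg₀C (subset_tsupport _ hgy)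
    refine ⟨κ'.inv y, ⟨⟨y, hyC, rfl⟩, ?_⟩, κ'.map_inv hyt⟩
    exact ⟨κ.map (κ'.inv y), hmC, κ.inv_map hxs⟩

omit [IsManifold I ∞ M] [I.Boundaryless] [T2Space M] in
/-- **First transport identity**: for `g` supported in `tsupport cut_p`,
`rhoExpr q (globalize_p g) y = (ρ̂_q · globalize_p cutPlus_p ∘ κ_q⁻¹)(y) • g (τ_{qp} y)`.
[cite: Lee2013, Thm. 2.23] -/
theorem rhoExpr_globalize_eq (q p : ι) {g : E' → F} (hg : ∀ y, g y ≠ 0 → y ∈ tsupport (P.cut p)) (y : E') :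
    rhoExpr P q ((P.chart p).globalize g) y =
      (P.rhoHat q y * (P.chart p).globalize (P.cutPlus p) ((P.chart q).inv y)) • g ((P.chart q).transition (P.chart p) y) := by
  rw [rhoExpr_apply, FramedChart.transition_apply]
  by_cases hxs : (P.chart q).inv y ∈ (P.chart p).source
  · rw [(P.chart p).globalize_of_mem hxs, (P.chart p).globalize_of_mem hxs]
    by_cases h0 : g ((P.chart p).map ((P.chart q).inv y)) = 0
    · rw [h0, smul_zero, smul_zero]
    · rw [P.cutPlus_eq_one_of_mem_tsupport_cut p (hg _ h0), mul_one]
  · rw [(P.chart p).globalize_of_notMem hxs, (P.chart p).globalize_of_notMem hxs, smul_zero, mul_zero, zero_smul]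

omit [IsManifold I ∞ M] [I.Boundaryless] [T2Space M] in
/-- **Second transport identity**: `cutExpr p f y = Σ_q (cut_p · globalize_q cut_q ∘ κ_p⁻¹)(y) • rhoExpr q f (τ_{pq} y)`.
[cite: Lee2013, Thm. 2.23] -/
theorem cutExpr_eq_sum_rhoExpr (p : ι) (f : M → F) (y : E') :
    cutExpr P p f y = ∑ q, (P.cut p y * (P.chart q).globalize (P.cut q) ((P.chart p).inv y)) •
      rhoExpr P q f ((P.chart p).transition (P.chart q) y) := by
  rw [cutExpr_eq_smul]
  simp only
  by_cases hyt : y ∈ (P.chart p).target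
  swap
  · have h0 : P.cut p y = 0 := image_eq_zero_of_notMem_tsupport fun h ↦ hyt (P.tsupport_cut_subset p h)
    simp [h0]
  set x := (P.chart p).inv y with hx
  have key : ∀ q, (P.cut p y * (P.chart q).globalize (P.cut q) x) • rhoExpr P q f ((P.chart p).transition (P.chart q) y) =
      P.cut p y • (P.rho q x • f x) := by
    intro q
    rw [FramedChart.transition_apply, ← hx]
    by_cases hqs : x ∈ (P.chart q).source
    · rw [(P.chart q).globalize_of_mem hqs, rhoExpr_apply, P.rhoHat_map q hqs, (P.chart q).inv_map hqs]
      by_cases hρ : P.rho q x = 0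
      · rw [hρ, zero_smul, smul_zero, smul_zero]
      · rw [P.cut_map_eq_one_of_rho_ne_zero q hρ, mul_one]
    · rw [(P.chart q).globalize_of_notMem hqs, P.rho_eq_zero_of_notMem q hqs, mul_zero, zero_smul, zero_smul, smul_zero]
  simp only [key, ← Finset.smul_sum, ← Finset.sum_smul, P.sum_rho x, one_smul]

/-! ### Energy transport between the two localisations -/

variable [MeasurableSpace E'] [BorelSpace E']

/-- **Energy of the partition expression of a globalisation**: for every `q, p, k` there is
`C < ∞` with `E_k(rhoExpr q (globalize_p g)) ≤ C E_k(g)` for all smooth `g` supported in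
`tsupport cut_p`. [cite: Adams1975, Thm. 3.35] -/
theorem exists_rhoExpr_globalize_le (q p : ι) (k : ℕ) :
    ∃ C : ℝ≥0∞, C ≠ ⊤ ∧ ∀ {g : E' → F}, ContDiff ℝ ∞ g → (∀ y, g y ≠ 0 → y ∈ tsupport (P.cut p)) →
      sobolevEnergy k (rhoExpr P q ((P.chart p).globalize g)) ≤ C * sobolevEnergy k g := by
  have hθt : tsupport (P.rhoHat q) ⊆ (P.chart q).target :=
    (P.tsupport_rhoHat_subset q).trans (P.closedBall_subset_target q (by norm_num))
  have hm : ContDiff ℝ ∞ fun y ↦ P.rhoHat q y * (P.chart p).globalize (P.cutPlus p) ((P.chart q).inv y) :=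
    contDiff_mul_globalize_comp_inv (P.chart p) (P.chart q) (P.contDiff_rhoHat q) hθt (P.cutPlus p).contDiff
      (isCompact_closedBall 0 (4 * P.r p)) (P.closedBall_subset_target p le_rfl)
      (by rw [ContDiffBump.tsupport_eq, PatchSystem.cutPlus_rOut])
  obtain ⟨K, hK, hKV, hmK⟩ := exists_compact_tsupport_mul_globalize_subset (P.chart p) (P.chart q)
    (isCompact_closedBall 0 (2 * P.r q)) (P.closedBall_subset_target q (by norm_num)) (P.tsupport_rhoHat_subset q)
    (g₀ := P.cutPlus p) (isCompact_closedBall 0 (4 * P.r p)) (P.closedBall_subset_target p le_rfl)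
    (by rw [ContDiffBump.tsupport_eq, PatchSystem.cutPlus_rOut])
  obtain ⟨C, hCtop, hC⟩ := sobolevEnergy_smul_comp_transition_le P (F := F) p hm hK hKV hmK k
  refine ⟨C, hCtop, fun {g} hg hgs ↦ ?_⟩
  have heq : rhoExpr P q ((P.chart p).globalize g) = fun y ↦
      (P.rhoHat q y * (P.chart p).globalize (P.cutPlus p) ((P.chart q).inv y)) • g ((P.chart q).transition (P.chart p) y) :=
    funext fun y ↦ rhoExpr_globalize_eq P q p hgs y
  rw [heq]
  exact hC hg

/-- **Energy of the cut-off expression in terms of the partition expressions**: for every `p, k`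
there is `C < ∞` with `E_k(cutExpr p f) ≤ C Σ_q E_k(rhoExpr q f)` for all `f` with smooth chart
expressions. [cite: Adams1975, Thm. 3.35] -/
theorem exists_cutExpr_le_sum_rhoExpr (p : ι) (k : ℕ) :
    ∃ C : ℝ≥0∞, C ≠ ⊤ ∧ ∀ {f : M → F}, (∀ q, ContDiffOn ℝ ∞ (f ∘ (P.chart q).inv) (P.chart q).target) →
      sobolevEnergy k (cutExpr P p f) ≤ C * ∑ q, sobolevEnergy k (rhoExpr P q f) := by
  classical
  have hq : ∀ q, ∃ C : ℝ≥0∞, C ≠ ⊤ ∧ ∀ {g : E' → F}, ContDiff ℝ ∞ g →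
      sobolevEnergy k (fun y ↦ (P.cut p y * (P.chart q).globalize (P.cut q) ((P.chart p).inv y)) •
        g ((P.chart p).transition (P.chart q) y)) ≤ C * sobolevEnergy k g := by
    intro q
    have hm : ContDiff ℝ ∞ fun y ↦ P.cut p y * (P.chart q).globalize (P.cut q) ((P.chart p).inv y) :=
      contDiff_mul_globalize_comp_inv (P.chart q) (P.chart p) (P.cut p).contDiff (P.tsupport_cut_subset p) (P.cut q).contDiff
        (isCompact_closedBall 0 (3 * P.r q)) (P.closedBall_subset_target q (by norm_num))
        (by rw [ContDiffBump.tsupport_eq, PatchSystem.cut_rOut])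
    obtain ⟨K, hK, hKV, hmK⟩ := exists_compact_tsupport_mul_globalize_subset (P.chart q) (P.chart p) (θ := P.cut p)
      (isCompact_closedBall 0 (3 * P.r p)) (P.closedBall_subset_target p (by norm_num))
      (by rw [ContDiffBump.tsupport_eq, PatchSystem.cut_rOut]) (g₀ := P.cut q) (isCompact_closedBall 0 (3 * P.r q))
      (P.closedBall_subset_target q (by norm_num)) (by rw [ContDiffBump.tsupport_eq, PatchSystem.cut_rOut])
    exact sobolevEnergy_smul_comp_transition_le P (F := F) q hm hK hKV hmK k
  choose C hCtop hC using hq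
  refine ⟨(Fintype.card ι : ℝ≥0∞) * ∑ q, C q, ENNReal.mul_ne_top (ENNReal.natCast_ne_top _)
    (ENNReal.sum_ne_top.2 fun q _ ↦ hCtop q), fun {f} hf ↦ ?_⟩
  have hsm : ∀ q, ContDiff ℝ ∞ (rhoExpr P q f) := fun q ↦ contDiff_rhoExpr P q (hf q)
  have heq : cutExpr P p f = fun y ↦ ∑ q, (P.cut p y * (P.chart q).globalize (P.cut q) ((P.chart p).inv y)) •
      rhoExpr P q f ((P.chart p).transition (P.chart q) y) := funext fun y ↦ cutExpr_eq_sum_rhoExpr P p f y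
  rw [heq]
  have hterm : ∀ q, ContDiff ℝ k fun y ↦ (P.cut p y * (P.chart q).globalize (P.cut q) ((P.chart p).inv y)) •
      rhoExpr P q f ((P.chart p).transition (P.chart q) y) := by
    intro q
    -- a transport of a smooth function with a multiplier compactly supported in the overlap is smooth
    have hm : ContDiff ℝ ∞ fun y ↦ P.cut p y * (P.chart q).globalize (P.cut q) ((P.chart p).inv y) :=
      contDiff_mul_globalize_comp_inv (P.chart q) (P.chart p) (P.cut p).contDiff (P.tsupport_cut_subset p) (P.cut q).contDiff
        (isCompact_closedBall 0 (3 * P.r q)) (P.closedBall_subset_target q (by norm_num))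
        (by rw [ContDiffBump.tsupport_eq, PatchSystem.cut_rOut])
    obtain ⟨K, hK, hKV, hmK⟩ := exists_compact_tsupport_mul_globalize_subset (P.chart q) (P.chart p) (θ := P.cut p)
      (isCompact_closedBall 0 (3 * P.r p)) (P.closedBall_subset_target p (by norm_num))
      (by rw [ContDiffBump.tsupport_eq, PatchSystem.cut_rOut]) (g₀ := P.cut q) (isCompact_closedBall 0 (3 * P.r q))
      (P.closedBall_subset_target q (by norm_num)) (by rw [ContDiffBump.tsupport_eq, PatchSystem.cut_rOut])
    exact (contDiff_smul_comp_of_tsupport_subset ((P.chart p).isOpen_overlap (P.chart q))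
      ((P.chart p).contDiffOn_transition (P.chart q)) hKV hm hmK (hsm q)).of_le (by exact_mod_cast le_top)
  calc sobolevEnergy k (fun y ↦ ∑ q, (P.cut p y * (P.chart q).globalize (P.cut q) ((P.chart p).inv y)) •
        rhoExpr P q f ((P.chart p).transition (P.chart q) y))
      ≤ (Fintype.card ι : ℝ≥0∞) * ∑ q, sobolevEnergy k (fun y ↦ (P.cut p y * (P.chart q).globalize (P.cut q)
          ((P.chart p).inv y)) • rhoExpr P q f ((P.chart p).transition (P.chart q) y)) := by
        have h := sobolevEnergy_sum_le_card k Finset.univ (fun q _ ↦ hterm q)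
        rwa [Finset.card_univ] at h
    _ ≤ (Fintype.card ι : ℝ≥0∞) * ∑ q, C q * sobolevEnergy k (rhoExpr P q f) :=
        mul_le_mul' le_rfl (Finset.sum_le_sum fun q _ ↦ hC q (hsm q))
    _ ≤ (Fintype.card ι : ℝ≥0∞) * ∑ q, (∑ q', C q') * sobolevEnergy k (rhoExpr P q f) :=
        mul_le_mul' le_rfl (Finset.sum_le_sum fun q _ ↦ mul_le_mul'
          (Finset.single_le_sum (f := C) (fun _ _ ↦ bot_le) (Finset.mem_univ q)) le_rfl)
    _ = _ := by rw [← Finset.mul_sum, mul_assoc]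

end PatchSystemLoc

end Literature.Analysis.PDE
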